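import Summits.KontsevichZagierPeriods.KontsevichZagierPeriods.Theorems.LinRedNormalFormArrangementNormalFormSeparateThreeHHKSecPrep
import Summits.KontsevichZagierPeriods.KontsevichZagierPeriods.Theorems.LinRedNormalFormArrangementNormalFormSeparateThreeHHKSectorB
import Summits.KontsevichZagierPeriods.KontsevichZagierPeriods.Theorems.LinRedNormalFormArrangementNormalFormSeparateThreeHHKFormsB
import Summits.KontsevichZagierPeriods.KontsevichZagierPeriods.Theorems.LinRedNormalFormArrangementNormalFormSeparateTwoHICover

/-!
# The sector theorems at a direction of the pole plane: the adapted frame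

(Line `janus-bands`, crux `ArrangementNormalForm`, stub `stub_separateHigh`, part `HHKSecIIIPrep`
of the wall-invariant termwise-split lemma `separateThree_hHk` in base dimension `3` with fibres.)
At a base point `z₁` of the pole plane and a direction `d` IN the pole plane (`d′ ≠ 0`), the frame
plane of the nested sectors is spanned by the vertical vector `Evec = (0, 0, 1)` and the pole-plane
vector `cvec cw` over a second basis vector `cw` of the `x′`-plane; the frames are
`Q = Qy Evec + Qc cvec`, `S = Sy Evec + Sc cvec` (`frameIII`). This file computes, along such a
nested sector: the determinant (`det3_frameIII`), the `x′`-projection and the pole coordinate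
(`pr2_npt_frameIII`, `lam3_npt_frameIII`), and the numerator and its Taylor pieces in terms of
the adapted Taylor data `β` of part `HHKFormsB` (`num_npt_frameIII`: the pieces are
`G3p β Qy Sy Qc Sc i`, registered as `separateThreeHHK_secIIIPrep`); also `pev₃_sum` and bounds
for the rows of the pieces (`exists_Gam_bound`).
-/

noncomputable section

open Set MeasureTheory Filter Topology
open scoped ENNReal

namespace Summit.KontsevichZagierPeriods.ArrangementNormalForm.JanusBands

namespace SepHHK

open SepTwo

/-! ### The frame -/

/-- The vertical vector. -/
def Evec : Fin 3 → ℝ := ![0, 0, 1]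

/-- The pole-plane vector over `cw`. -/
def cvec (l₁ l₂ : ℝ) (cw : Fin 2 → ℝ) : Fin 3 → ℝ := ![cw 0, cw 1, l₁ * cw 0 + l₂ * cw 1]

/-- The frame vector with vertical component `Qy` and pole-plane component `Qc`. -/
def frameIII (l₁ l₂ : ℝ) (cw : Fin 2 → ℝ) (Qy Qc : ℝ) : Fin 3 → ℝ := Qy • Evec + Qc • cvec l₁ l₂ cw

/-- Coordinates of the frame vector. -/
theorem frameIII_apply (l₁ l₂ : ℝ) (cw : Fin 2 → ℝ) (Qy Qc : ℝ) :
    frameIII l₁ l₂ cw Qy Qc 0 = Qc * cw 0 ∧ frameIII l₁ l₂ cw Qy Qc 1 = Qc * cw 1 ∧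
      frameIII l₁ l₂ cw Qy Qc 2 = Qy + Qc * (l₁ * cw 0 + l₂ * cw 1) := by
  simp [frameIII, Evec, cvec]

/-- The pole coordinate of the frame vector. -/
theorem lamL_frameIII (l₁ l₂ : ℝ) (cw : Fin 2 → ℝ) (Qy Qc : ℝ) :
    lamL l₁ l₂ (frameIII l₁ l₂ cw Qy Qc) = Qy := by
  obtain ⟨h0, h1, h2⟩ := frameIII_apply l₁ l₂ cw Qy Qc
  rw [lamL, h0, h1, h2]; ring

/-- The letters on the frame vector. -/
theorem klin_frameIII {mL : ℕ} (κ : Fin mL → Fin 2 → ℝ) (j : Fin mL) (l₁ l₂ : ℝ) (cw : Fin 2 → ℝ)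
    (Qy Qc : ℝ) : klin κ j (frameIII l₁ l₂ cw Qy Qc) = Qc * (κ j 0 * cw 0 + κ j 1 * cw 1) := by
  obtain ⟨h0, h1, -⟩ := frameIII_apply l₁ l₂ cw Qy Qc
  rw [klin, h0, h1]; ring

/-- **The determinant of the adapted frame.** -/
theorem det3_frameIII (l₁ l₂ : ℝ) (d : Fin 3 → ℝ) (hd : lamL l₁ l₂ d = 0) (cw : Fin 2 → ℝ)
    (Qy Qc Sy Sc : ℝ) :
    det3 d (frameIII l₁ l₂ cw Qy Qc) (frameIII l₁ l₂ cw Sy Sc) =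
      (Qc * Sy - Qy * Sc) * (d 0 * cw 1 - d 1 * cw 0) := by
  obtain ⟨q0, q1, q2⟩ := frameIII_apply l₁ l₂ cw Qy Qc
  obtain ⟨s0, s1, s2⟩ := frameIII_apply l₁ l₂ cw Sy Sc
  have hd2 : d 2 = l₁ * d 0 + l₂ * d 1 := by rw [lamL] at hd; linarith
  rw [det3_eq, q0, q1, q2, s0, s1, s2, hd2]
  ring

/-- **The `x′`-projection along the adapted nested sector.** -/
theorem pr2_npt_frameIII (l₁ l₂ : ℝ) (z₁ d : Fin 3 → ℝ) (cw : Fin 2 → ℝ) (Qy Qc Sy Sc t v u : ℝ) :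
    pr2 (npt z₁ d (frameIII l₁ l₂ cw Qy Qc) (frameIII l₁ l₂ cw Sy Sc) t v u) =
      pr2 z₁ + t • pr2 d + (t * v * (Qc + u * Sc)) • cw := by
  obtain ⟨q0, q1, -⟩ := frameIII_apply l₁ l₂ cw Qy Qc
  obtain ⟨s0, s1, -⟩ := frameIII_apply l₁ l₂ cw Sy Sc
  funext k
  fin_cases k
  · show z₁ 0 + t * (d 0 + v * (frameIII l₁ l₂ cw Qy Qc 0 + u * frameIII l₁ l₂ cw Sy Sc 0)) =
      z₁ 0 + t * d 0 + t * v * (Qc + u * Sc) * cw 0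
    rw [q0, s0]; ring
  · show z₁ 1 + t * (d 1 + v * (frameIII l₁ l₂ cw Qy Qc 1 + u * frameIII l₁ l₂ cw Sy Sc 1)) =
      z₁ 1 + t * d 1 + t * v * (Qc + u * Sc) * cw 1
    rw [q1, s1]; ring

/-- **The pole coordinate along the adapted nested sector** at a point of the pole plane. -/
theorem lam3_npt_frameIII (l₁ l₂ l₀ : ℝ) (z₁ d : Fin 3 → ℝ) (hz : lam3 l₁ l₂ l₀ z₁ = 0)
    (hd : lamL l₁ l₂ d = 0) (cw : Fin 2 → ℝ) (Qy Qc Sy Sc t v u : ℝ) :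
    lam3 l₁ l₂ l₀ (npt z₁ d (frameIII l₁ l₂ cw Qy Qc) (frameIII l₁ l₂ cw Sy Sc) t v u) =
      t * v * (Qy + u * Sy) := by
  rw [lam3_npt, hz, hd, lamL_frameIII, lamL_frameIII]; ring

/-! ### The numerator along the adapted sector -/

/-- One Taylor piece in adapted form. -/
theorem pev₂_mul_eq_G3p {D : ℕ} (β : Coef₃ D) (Qy Sy Qc Sc : ℝ) (i : Fin (D + 1)) (t v u : ℝ) :
    pev₂ (β i) t (t * v * (Qc + u * Sc)) * (t * v * (Qy + u * Sy)) ^ (i : ℕ) =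
      G3p β Qy Sy Qc Sc i t v u := by
  unfold pev₂ G3p
  rw [Finset.sum_mul]
  refine Finset.sum_congr rfl fun r _ => ?_
  rw [Finset.sum_mul]
  refine Finset.sum_congr rfl fun j _ => ?_
  rw [mul_pow, mul_pow, mul_pow, mul_pow, pow_add, pow_add, pow_add]
  ring

/-- **The numerator and its pieces along the adapted nested sector.** -/
theorem num_npt_frameIII {D : ℕ} (N : ℕ) (q : ℕ → MvPolynomial (Fin 2) ℝ) (l₁ l₂ l₀ : ℝ)
    (z₁ d : Fin 3 → ℝ) (hz : lam3 l₁ l₂ l₀ z₁ = 0) (hd : lamL l₁ l₂ d = 0) (cw : Fin 2 → ℝ)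
    (hND : N ≤ D + 1) (β : Coef₃ D)
    (hβ : ∀ (i : ℕ) (hi : i < N) (w₁ w₂ : ℝ), MvPolynomial.eval (pr2 z₁ + w₁ • pr2 d + w₂ • cw) (q i) =
      pev₂ (β ⟨i, lt_of_lt_of_le hi hND⟩) w₁ w₂)
    (hβ0 : ∀ i : Fin (D + 1), N ≤ (i : ℕ) → β i = 0) (Qy Qc Sy Sc t v u : ℝ) :
    (∀ (i : ℕ) (hi : i < N), MvPolynomial.eval (pr2 (npt z₁ d (frameIII l₁ l₂ cw Qy Qc)
        (frameIII l₁ l₂ cw Sy Sc) t v u)) (q i) * lam3 l₁ l₂ l₀ (npt z₁ d (frameIII l₁ l₂ cw Qy Qc)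
        (frameIII l₁ l₂ cw Sy Sc) t v u) ^ i = G3p β Qy Sy Qc Sc ⟨i, lt_of_lt_of_le hi hND⟩ t v u) ∧
    (∑ i ∈ Finset.range N, MvPolynomial.eval (pr2 (npt z₁ d (frameIII l₁ l₂ cw Qy Qc)
        (frameIII l₁ l₂ cw Sy Sc) t v u)) (q i) * lam3 l₁ l₂ l₀ (npt z₁ d (frameIII l₁ l₂ cw Qy Qc)
        (frameIII l₁ l₂ cw Sy Sc) t v u) ^ i) = ∑ i : Fin (D + 1), G3p β Qy Sy Qc Sc i t v u := by
  have hpiece : ∀ (i : ℕ) (hi : i < N), MvPolynomial.eval (pr2 (npt z₁ d (frameIII l₁ l₂ cw Qy Qc)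
      (frameIII l₁ l₂ cw Sy Sc) t v u)) (q i) * lam3 l₁ l₂ l₀ (npt z₁ d (frameIII l₁ l₂ cw Qy Qc)
      (frameIII l₁ l₂ cw Sy Sc) t v u) ^ i = G3p β Qy Sy Qc Sc ⟨i, lt_of_lt_of_le hi hND⟩ t v u := by
    intro i hi
    rw [pr2_npt_frameIII, hβ i hi, lam3_npt_frameIII l₁ l₂ l₀ z₁ d hz hd]
    exact pev₂_mul_eq_G3p β Qy Sy Qc Sc ⟨i, lt_of_lt_of_le hi hND⟩ t v u
  refine ⟨hpiece, ?_⟩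
  rw [SepThree.sum_range_eq_sum_fin _ hND]
  refine Finset.sum_congr rfl fun i _ => ?_
  by_cases hi : (i : ℕ) < N
  · rw [if_pos hi, hpiece i hi]
  · rw [if_neg hi]
    unfold G3p
    simp [hβ0 i (not_lt.1 hi)]

/-- **The numerator is the bigraded sum of its rows.** -/
theorem sum_G3p_eq_rows {D : ℕ} (β : Coef₃ D) (Qy Sy Qc Sc t v u : ℝ) :
    (∑ i : Fin (D + 1), G3p β Qy Sy Qc Sc i t v u) =
      ∑ a : Fin (3 * D + 1), ∑ b : Fin (3 * D + 1), Hrow β Qy Sy Qc Sc a b u * t ^ (a : ℕ) * v ^ (b : ℕ) := by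
  simp_rw [G3p_eq_sum_Gam]
  rw [Finset.sum_comm]
  refine Finset.sum_congr rfl fun a _ => ?_
  rw [Finset.sum_comm]
  refine Finset.sum_congr rfl fun b _ => ?_
  unfold Hrow
  rw [Finset.sum_mul, Finset.sum_mul]

/-- The triple polynomial is additive in the coefficients. -/
theorem pev₃_add {D : ℕ} (c c' : Coef₃ D) (t v u : ℝ) :
    pev₃ (c + c') t v u = pev₃ c t v u + pev₃ c' t v u := by
  simp only [pev₃, Pi.add_apply, add_mul, Finset.sum_add_distrib]

/-- The triple polynomial of a finite sum of coefficient tensors. -/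
theorem pev₃_sum {D : ℕ} {ι : Type*} (T : Finset ι) (g : ι → Coef₃ D) (t v u : ℝ) :
    pev₃ (∑ p ∈ T, g p) t v u = ∑ p ∈ T, pev₃ (g p) t v u := by
  classical
  induction T using Finset.induction_on with
  | empty => simp [pev₃]
  | insert p T hp ih => rw [Finset.sum_insert hp, Finset.sum_insert hp, pev₃_add, ih]

/-- The rows of the numerator are continuous in `u`. -/
theorem continuous_Hrow {D : ℕ} (β : Coef₃ D) (Qy Sy Qc Sc : ℝ) (a b : Fin (3 * D + 1)) :
    Continuous (Hrow β Qy Sy Qc Sc a b) := by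
  unfold Hrow
  exact continuous_finsetSum _ fun i _ => continuous_Gam β Qy Sy Qc Sc i a b

/-- **Bounds for the rows of the pieces on the unit interval.** -/
theorem exists_Gam_bound {D : ℕ} (β : Coef₃ D) (Qy Sy Qc Sc : ℝ) :
    ∃ B : ℝ, 0 ≤ B ∧ ∀ (i : Fin (D + 1)) (a b : Fin (3 * D + 1)), ∀ u ∈ Icc (0 : ℝ) 1,
      |Gam β Qy Sy Qc Sc i a b u| ≤ B := by
  set f : ℝ → ℝ := fun u => ∑ i : Fin (D + 1), ∑ a : Fin (3 * D + 1), ∑ b : Fin (3 * D + 1),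
    |Gam β Qy Sy Qc Sc i a b u| with hf
  have hfc : Continuous f := continuous_finsetSum _ fun i _ => continuous_finsetSum _ fun a _ =>
    continuous_finsetSum _ fun b _ => (continuous_Gam β Qy Sy Qc Sc i a b).abs
  obtain ⟨B, hB⟩ := isCompact_Icc.exists_bound_of_continuousOn (hfc.continuousOn (s := Icc (0 : ℝ) 1))
  refine ⟨max B 0, le_max_right _ _, fun i a b u hu => ?_⟩
  have h := hB u hu
  rw [Real.norm_eq_abs, abs_of_nonneg (Finset.sum_nonneg fun _ _ => Finset.sum_nonneg fun _ _ =>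
    Finset.sum_nonneg fun _ _ => abs_nonneg _)] at h
  refine le_trans ?_ (h.trans (le_max_left _ _))
  refine le_trans ?_ (Finset.single_le_sum (f := fun i' : Fin (D + 1) => ∑ a : Fin (3 * D + 1),
    ∑ b : Fin (3 * D + 1), |Gam β Qy Sy Qc Sc i' a b u|)
    (fun _ _ => Finset.sum_nonneg fun _ _ => Finset.sum_nonneg fun _ _ => abs_nonneg _) (Finset.mem_univ i))
  refine le_trans ?_ (Finset.single_le_sum (f := fun a' : Fin (3 * D + 1) =>
    ∑ b : Fin (3 * D + 1), |Gam β Qy Sy Qc Sc i a' b u|)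
    (fun _ _ => Finset.sum_nonneg fun _ _ => abs_nonneg _) (Finset.mem_univ a))
  exact Finset.single_le_sum (f := fun b' : Fin (3 * D + 1) => |Gam β Qy Sy Qc Sc i a b' u|)
    (fun _ _ => abs_nonneg _) (Finset.mem_univ b)

/-- A vanishing row polynomial makes the row vanish everywhere. -/
theorem Hrow_zero_of_Rrow_zero {D : ℕ} (β : Coef₃ D) (Qy Sy Qc Sc : ℝ) (a b : Fin (3 * D + 1))
    (h : Rrow β Qy Sy Qc Sc a b = 0) (u : ℝ) : Hrow β Qy Sy Qc Sc a b u = 0 := by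
  rw [← eval_Rrow, h, Polynomial.eval_zero]

/-- **Root-free scales for the non-zero rows.** There is `η₂ ∈ (0, 1]` such that every non-zero
row polynomial has no roots on `(0, η₂)`. -/
theorem exists_rows_rootfree {D : ℕ} (β : Coef₃ D) (Qy Sy Qc Sc : ℝ) :
    ∃ η₂ : ℝ, 0 < η₂ ∧ η₂ ≤ 1 ∧ ∀ (a b : Fin (3 * D + 1)), Rrow β Qy Sy Qc Sc a b ≠ 0 →
      ∀ u ∈ Ioo 0 η₂, Hrow β Qy Sy Qc Sc a b u ≠ 0 := by
  classical
  have hrow : ∀ ab : Fin (3 * D + 1) × Fin (3 * D + 1), ∃ u₁ : ℝ, 0 < u₁ ∧ u₁ ≤ 1 ∧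
      (Rrow β Qy Sy Qc Sc ab.1 ab.2 ≠ 0 → ∀ u ∈ Ioo 0 u₁, Hrow β Qy Sy Qc Sc ab.1 ab.2 u ≠ 0) := by
    intro ab
    by_cases h0 : Rrow β Qy Sy Qc Sc ab.1 ab.2 = 0
    · exact ⟨1, one_pos, le_rfl, fun h => absurd h0 h⟩
    · obtain ⟨u₁, hu₁, hu₁1, hroot⟩ := exists_rootfree _ h0
      refine ⟨u₁, hu₁, hu₁1, fun _ u hu => ?_⟩
      rw [← eval_Rrow]; exact hroot u hu
  choose u₁ hu₁ hu₁1 hroot using hrow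
  obtain ⟨η₂, hη₂, hη₂le⟩ := exists_pos_le_finset Finset.univ u₁ fun ab _ => hu₁ ab
  obtain ⟨ab₀⟩ : Nonempty (Fin (3 * D + 1) × Fin (3 * D + 1)) := ⟨(0, 0)⟩
  refine ⟨η₂, hη₂, (hη₂le ab₀ (Finset.mem_univ _)).trans (hu₁1 ab₀), fun a b hab u hu => ?_⟩
  exact hroot (a, b) hab u ⟨hu.1, hu.2.trans_le (hη₂le (a, b) (Finset.mem_univ _))⟩

end SepHHK

/-- **The Taylor pieces along an adapted nested sector at a direction of the pole plane**
(registered part of `stub_separateHigh`, base dimension `3` with fibres; literal consequence of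
`SepHHK.num_npt_frameIII`): at a base point of the pole plane, along the nested sector with frame
`Qy E + Qc c, Sy E + Sc c` at a pole-plane direction `d`, the numerator `∑_{i<N} qᵢ(x′) λ(x)^i` is
the sum of the explicit adapted pieces `SepHHK.G3p β Qy Sy Qc Sc i`. -/
theorem separateThreeHHK_secIIIPrep (D N : ℕ) (q : ℕ → MvPolynomial (Fin 2) ℝ) (l₁ l₂ l₀ : ℝ) (z₁ d : Fin 3 → ℝ) (hz : SepHHK.lam3 l₁ l₂ l₀ z₁ = 0) (hd : SepHHK.lamL l₁ l₂ d = 0) (cw : Fin 2 → ℝ) (hND : N ≤ D + 1) (β : Fin (D + 1) → Fin (D + 1) → Fin (D + 1) → ℝ) (hβ : ∀ (i : ℕ) (hi : i < N) (w₁ w₂ : ℝ), MvPolynomial.eval (SepHHK.pr2 z₁ + w₁ • SepHHK.pr2 d + w₂ • cw) (q i) = SepTwo.pev₂ (β ⟨i, lt_of_lt_of_le hi hND⟩) w₁ w₂) (hβ0 : ∀ i : Fin (D + 1), N ≤ (i : ℕ) → β i = 0) (Qy Qc Sy Sc t v u : ℝ) : (∑ i ∈ Finset.range N, MvPolynomial.eval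 (SepHHK.pr2 (SepHHK.npt z₁ d (SepHHK.frameIII l₁ l₂ cw Qy Qc) (SepHHK.frameIII l₁ l₂ cw Sy Sc) t v u)) (q i) * SepHHK.lam3 l₁ l₂ l₀ (SepHHK.npt z₁ d (SepHHK.frameIII l₁ l₂ cw Qy Qc) (SepHHK.frameIII l₁ l₂ cw Sy Sc) t v u) ^ i) = ∑ i : Fin (D + 1), SepHHK.G3p β Qy Sy Qc Sc i t v u := by
  exact (SepHHK.num_npt_frameIII N q l₁ l₂ l₀ z₁ d hz hd cw hND β hβ hβ0 Qy Qc Sy Sc t v u).2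

end Summit.KontsevichZagierPeriods.ArrangementNormalForm.JanusBands
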